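/-
Copyright (c) 2026 the pub-hodgecm-mathlib formalisation cell (harness21).  Prover seat hodgecm-mathlib-F0P3a-p04 (g30); dealer LH4-plan (g8) WORD #38 DEAL g8-#6 = F2 under
LEAD F0P3a-plan (g15) T14-66 «ROAD-LIMITED GO» (M6 «ROW 2 ★ DYADIC TWIN»); ENGINE-CENSUS «(O4) M6» v1.1∕v1.3 §2 E-D, 2026-09-02.
-/
import Mathlib.RingTheory.Henselian
import Mathlib.LinearAlgebra.Matrix.Charpoly.Coeff
import Mathlib.Topology.Algebra.Valued.ValuedField
import Literature.NumberTheory.LocalFields.ValuedPrincipalUnitsProP   -- ★ light `Valued` toolkit: `lt_one_iff_le_exp_neg_one`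
import HarnessLib

/-!
# EISENSTEIN DATA of a type-(2) element: the uniformiser `Θ = α•1 + β•g` of the order `L_w[g] ⊂ M₂(L_w)`, the coordinates `u•1 − g = a•1 + b•Θ`, and the 2-free
# VALUE LAW `ord det(a•1 + b•Θ) = min(2·ord a, 2·ord b + 1)` — at ANY residue characteristic; the `|2| = 1` reading `Θ = ϖ^{−N}(2g − tr g)`, `N = ord b` as a corollary

Topic `NumberTheory/Rogawski1990`; namespace `Literature.NumberTheory.Rogawski1990`.  THEOREMS ONLY (no definition, no instance, no notation, no named fact, no `sorry`); generic `[Field K] [Valued K ℤᵐ⁰]` (+ `[HenselianLocalRing 𝒪[K]]` where Hensel's lemma is used — at `K = L_w` this is Mathlib's instance on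
`w.adicCompletionIntegers L`, invoked as in ★ `AdicCompletionUnitSquareClasses` by `inferInstanceAs`); NO `IsUnit 2`, NO different∕discriminant-exponent binder, NO `htr`.
Cell `pub/hodgecm-mathlib` (D-0151), crux H413 = `stmt-HodgeConjecture-24833`, line F0_P3c_DyadicPaydown (LH4), road M6 «ROW 2 ★ DYADIC TWIN» (LEAD T14-66), brick **F2
«EISENSTEIN DATA»** = the binder package `(Θ, α, β, a, b, n′, N′)` of ★ (W1) `SelfDualLatticeFixOrderOnly.ncard_vertex_rowZero_eq_of_total`'s hypothesis `hT`, token for token: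
`Θ = α • 1 + β • g`, `Valued.v Θ.det = Valued.v ϖ`, `Valued.v Θ.trace < 1`, `u • 1 - g = a • 1 + b • Θ`, `Valued.v (u • 1 - g).det = Valued.v ϖ ^ n′`, `Valued.v b = Valued.v ϖ ^ N′`.
HONEST LABEL: count-neutral road brick (no organ, no row, no registry act); (D-UNR)∕(D-RAM) PRINT by D74′; `stub_N6nsDyadic` = PRINT [LS₂]; HC_CM is proved only modulo the 7
printed citations (2 remaining named inputs hLiu418 = stmt-HodgeConjecture-24832, h413 = stmt-HodgeConjecture-24833) until rung 0 closes.  Nothing printed is asserted here.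

THE MATHEMATICS (all inside `M₂(K)`, no eigen-field object).  `g ∈ M₂(K)` with `χ_g` without a root in `K` (`hirr`, the ★ head's binder `DepthZeroKappaTransferTypeTwoGSide` :233)
and `|det g| ≤ 1`; `ϖ` a uniformiser (`|ϖ| = exp(−1)`).
* §1 VALUE LAW (pure ultrametrics in `K`): if `|det Θ| = |ϖ|` and `|tr Θ| ≤ |ϖ|` then for ALL `p, q ∈ K`, `|det(p•1 + q•Θ)| = |p² + pq·tr Θ + q²·det Θ| = max(|p|², |q|²·|ϖ|)`
  — the three terms have values `|p|²`, `≤ |p||q||ϖ|`, `|q|²|ϖ|`, and `|p|² ≠ |q|²|ϖ|` by PARITY of `log` (this is where «2-free» lives: no `(t ± y√d)∕2`).  Exponent form: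
  `|a| = |ϖ|^k`, `|b| = |ϖ|^N` ⇒ `|det(a•1 + b•Θ)| = |ϖ|^{min(2k, 2N+1)}`; `a = 0` ⇒ `|ϖ|^{2N+1}`; and backwards `|det(p•1 + q•Θ)| ≤ 1 ⇒ |p| ≤ 1 ∧ |q| ≤ 1` (the Eisenstein
  integral basis `𝒪_{K₂} = 𝒪 ⊕ 𝒪Θ`, read through the norm).
* §2 COORDINATES (any field): `Θ = α•1 + β•g`, `β ≠ 0` ⇒ `g = (−αβ⁻¹)•1 + β⁻¹•Θ` and `u•1 − g = (u + αβ⁻¹)•1 + (−β⁻¹)•Θ`; a root of `χ_{α•1+β•g}` gives a root of `χ_g`.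
* §3 HENSEL: if `χ_x` has no root in `K` and `|det x| < 1` then `|tr x| < 1` — else `Y² − Y + det x∕(tr x)²` has the simple root `0` mod `𝔪`, Hensel lifts it, and `(tr x)·y₀` is a
  root of `χ_x = X² − tr x·X + det x`.  So a NORM-UNIFORMISER of the order (`|det Θ| = |ϖ|`) automatically has `|tr Θ| < 1` (hence `≤ |ϖ|`): `Θ` is an Eisenstein generator.
* §4 EXISTENCE OF THE EISENSTEIN DATA from ONE seam binder `hram : |det(α₀•1 + β₀•g)| = |ϖ|` («the norm form of `K[g]` represents `ϖ`» ⟺ `K[g]∕K` RAMIFIED; at `|2| = 1` it is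
  §5's `ϖ^{−N}(2g − tr g)` from the ★ head's `hN`; at `v ∣ 2` it is F4-a's descent ∕ the wild normal form — the ONE input this file does not manufacture): `Θ := α₀•1 + β₀•g`
  (`β₀ ≠ 0` since `|α₀²| ≠ |ϖ|`), `|tr Θ| < 1` by §3, `(a, b) := (u + α₀β₀⁻¹, −β₀⁻¹)` by §2, `|a| ≤ 1`, `|b| ≤ 1` by §1 backwards from `|det g| ≤ 1`, `|u| ≤ 1`, hence
  `N′ := ord b`, `n′ := ord det(u•1 − g) = min(2·ord a, 2N′+1)` (or `2N′+1` if `a = 0`): ALL SIX `hT` CLAUSES + the value law + `Even n′ ∨ n′ = 2N′+1` + `n′ ≤ 2N′+1`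
  (the ★ head's `hpar`∕`hnN` as THEOREMS).
* §5 `|2| = 1` DICTIONARY (corollary only): `Θ := ϖ^{−N} • (2•g − tr g•1)` has `det = −ϖ^{−2N}(tr² − 4 det)`, `tr = 0`; with `|tr g² − 4 det g| = |ϖ|^{2N+1}` (★ `hN`) and
  `|2| = 1`: `|det Θ| = |ϖ|`, `u•1 − g = (u − tr g∕2)•1 + (−ϖ^N∕2)•Θ`, `|b| = |ϖ|^N` — every ★ tame row is the `d = 1` instance, `N′ = N`, `n′ = n`.

## References
* [SerreLocalFields1979] J.-P. Serre, *Local Fields*, GTM 67 (1979): Ch. I §6 Prop. 17–18 (Eisenstein equations, `𝒪_{K₂} = 𝒪[Π]`), Ch. II §4 Prop. 7 (Hensel).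
* [Rogawski1990] J. D. Rogawski, *Automorphic Representations of Unitary Groups in Three Variables* (1990): §4.9 Prop. 4.9.1 (b) p. 55, Lemma 4.9.3 p. 56.
* [Omeara1963] O. T. O'Meara, *Introduction to Quadratic Forms* (1963): §63A 63:2–63:5 (dyadic ramified quadratic extensions).
* [Jacobowitz1962] R. Jacobowitz, *Hermitian forms over local fields*, Amer. J. Math. 84 (1962): §5, §§9–11.
-/

set_option autoImplicit false

noncomputable section

open scoped Valued WithZero Matrix
open WithZero Polynomial

namespace Literature.NumberTheory.Rogawski1990

variable {K : Type*} [Field K] [Valued K ℤᵐ⁰]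

/-! ## §0 `ℤᵐ⁰` bookkeeping -/

/-- `exp(−1)^k = exp(−k)`. [cite: SerreLocalFields1979, Ch. I §6] -/
theorem exp_neg_one_pow (k : ℕ) : (exp (-1 : ℤ)) ^ k = exp (-(k : ℤ)) := by
  rw [← exp_nsmul]
  congr 1
  simp

/-- A square value is never `exp` of an odd integer: `γ² ≠ exp(−1)·exp(2m)`; in particular `γ ^ 2 ≠ δ ^ 2 * exp (-1)` unless both sides vanish. [cite: SerreLocalFields1979, Ch. I §6] -/
theorem sq_ne_sq_mul_exp_neg_one {γ δ : ℤᵐ⁰} (h : γ ≠ 0 ∨ δ ≠ 0) : γ ^ 2 ≠ δ ^ 2 * exp (-1 : ℤ) := by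
  intro e
  rcases eq_or_ne γ 0 with hγ | hγ
  · rw [hγ, zero_pow two_ne_zero, eq_comm, mul_eq_zero] at e
    rcases e with e | e
    · exact (h.resolve_left (not_not.2 hγ)) ((pow_eq_zero_iff two_ne_zero).1 e)
    · exact exp_ne_zero e
  rcases eq_or_ne δ 0 with hδ | hδ
  · rw [hδ, zero_pow two_ne_zero, zero_mul] at e
    exact pow_ne_zero 2 hγ e
  · rw [← exp_log hγ, ← exp_log hδ, ← exp_nsmul, ← exp_nsmul, ← exp_add, exp_inj, two_nsmul, two_nsmul] at e
    omega

/-- An element of value `≤ 1` and `≠ 0` has value `exp(−k)` for some `k : ℕ`. [cite: SerreLocalFields1979, Ch. I §6] -/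
theorem exists_v_eq_exp_neg_nat {x : K} (hx : x ≠ 0) (hx1 : Valued.v x ≤ 1) : ∃ k : ℕ, Valued.v x = exp (-(k : ℤ)) := by
  have h0 : Valued.v x ≠ 0 := (Valuation.ne_zero_iff _).2 hx
  have hm : log (Valued.v x) ≤ 0 := by
    rw [← exp_le_exp, exp_log h0, exp_zero]
    exact hx1
  refine ⟨(-log (Valued.v x)).toNat, ?_⟩
  rw [Int.toNat_of_nonneg (by omega), neg_neg, exp_log h0]

/-! ## §1 THE VALUE LAW of the norm form `det(p•1 + q•Θ) = p² + pq·tr Θ + q²·det Θ` -/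

/-- `det(p•1 + q•Θ) = p² + p q·tr Θ + q²·det Θ` (`2 × 2`). [cite: SerreLocalFields1979, Ch. I §6] -/
theorem det_smul_one_add_smul_fin_two {R : Type*} [CommRing R] (p q : R) (Θ : Matrix (Fin 2) (Fin 2) R) :
    (p • (1 : Matrix (Fin 2) (Fin 2) R) + q • Θ).det = p ^ 2 + p * q * Θ.trace + q ^ 2 * Θ.det := by
  simp [Matrix.det_fin_two, Matrix.trace_fin_two]
  ring

/-- **THE VALUE LAW, `max` form**: `|det Θ| = |ϖ| = exp(−1)`, `|tr Θ| ≤ |ϖ|` ⇒ `|det(p•1 + q•Θ)| = max(|p|², |q|²·|ϖ|)` for all `p q`. [cite: SerreLocalFields1979, Ch. I §6 Prop. 17–18] -/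
theorem v_det_smul_one_add_smul_eq_max {ϖ : K} (hϖ : Valued.v ϖ = exp (-1 : ℤ)) {Θ : Matrix (Fin 2) (Fin 2) K}
    (hΘd : Valued.v Θ.det = Valued.v ϖ) (hΘt : Valued.v Θ.trace ≤ Valued.v ϖ) (p q : K) :
    Valued.v (p • (1 : Matrix (Fin 2) (Fin 2) K) + q • Θ).det = max (Valued.v p ^ 2) (Valued.v q ^ 2 * Valued.v ϖ) := by
  have hϖ0 : Valued.v ϖ ≠ 0 := by rw [hϖ]; exact exp_ne_zero
  rw [det_smul_one_add_smul_fin_two]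
  -- values of the three terms
  have h1 : Valued.v (p ^ 2) = Valued.v p ^ 2 := map_pow _ _ _
  have h2 : Valued.v (p * q * Θ.trace) ≤ Valued.v p * Valued.v q * Valued.v ϖ := by
    rw [map_mul, map_mul]
    exact mul_le_mul_right hΘt _
  have h3 : Valued.v (q ^ 2 * Θ.det) = Valued.v q ^ 2 * Valued.v ϖ := by rw [map_mul, map_pow, hΘd]
  rcases eq_or_ne p 0 with hp | hp
  · subst hp
    simp only [ne_eq, OfNat.ofNat_ne_zero, not_false_eq_true, zero_pow, zero_mul, zero_add, map_zero]
    rw [h3, max_eq_right zero_le]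
  rcases eq_or_ne q 0 with hq | hq
  · subst hq
    simp only [ne_eq, OfNat.ofNat_ne_zero, not_false_eq_true, zero_pow, mul_zero, zero_mul, add_zero, map_zero]
    rw [h1, max_eq_left zero_le]
  -- `p, q ≠ 0`: write the values as `exp`
  have hp0 : Valued.v p ≠ 0 := (Valuation.ne_zero_iff _).2 hp
  have hq0 : Valued.v q ≠ 0 := (Valuation.ne_zero_iff _).2 hq
  set m := log (Valued.v p) with hm
  set m' := log (Valued.v q) with hm'
  have hP : Valued.v p = exp m := (exp_log hp0).symm
  have hQ : Valued.v q = exp m' := (exp_log hq0).symm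
  have e1 : Valued.v (p ^ 2) = exp (2 * m) := by rw [h1, hP, ← exp_nsmul, nsmul_eq_mul, Nat.cast_ofNat]
  have e2 : Valued.v (p * q * Θ.trace) ≤ exp (m + m' + (-1)) := by rw [exp_add, exp_add, ← hP, ← hQ, ← hϖ]; exact h2
  have e3 : Valued.v (q ^ 2 * Θ.det) = exp (2 * m' + (-1)) := by rw [h3, hQ, hϖ, ← exp_nsmul, ← exp_add, nsmul_eq_mul, Nat.cast_ofNat]
  have eM1 : Valued.v p ^ 2 = exp (2 * m) := by rw [← h1, e1]
  have eM3 : Valued.v q ^ 2 * Valued.v ϖ = exp (2 * m' + (-1)) := by rw [← h3, e3]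
  rw [eM1, eM3]
  rcases le_or_gt m' m with hle | hlt
  · -- the `p²` term dominates strictly
    have hlt2 : Valued.v (p * q * Θ.trace) < exp (2 * m) := lt_of_le_of_lt e2 (by rw [exp_lt_exp]; omega)
    have hlt3 : Valued.v (q ^ 2 * Θ.det) < exp (2 * m) := by rw [e3, exp_lt_exp]; omega
    rw [max_eq_left (by rw [exp_le_exp]; omega), add_assoc, Valuation.map_add_eq_of_lt_left _ (by rw [e1]; exact Valuation.map_add_lt _ hlt2 hlt3), e1]
  · -- the `q²·det Θ` term dominates strictly
    have hlt1 : Valued.v (p ^ 2) < exp (2 * m' + (-1)) := by rw [e1, exp_lt_exp]; omega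
    have hlt2 : Valued.v (p * q * Θ.trace) < exp (2 * m' + (-1)) := lt_of_le_of_lt e2 (by rw [exp_lt_exp]; omega)
    rw [max_eq_right (by rw [exp_le_exp]; omega), Valuation.map_add_eq_of_lt_right _ (by rw [e3]; exact Valuation.map_add_lt _ hlt1 hlt2), e3]

/-- **THE VALUE LAW, exponent form**: `|a| = |ϖ|^k`, `|b| = |ϖ|^N` ⇒ `|det(a•1 + b•Θ)| = |ϖ|^{min(2k, 2N+1)}`. [cite: SerreLocalFields1979, Ch. I §6 Prop. 17–18] [cite: Rogawski1990, §4.9 p. 55] -/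
theorem v_det_smul_one_add_smul_eq_pow_min {ϖ : K} (hϖ : Valued.v ϖ = exp (-1 : ℤ)) {Θ : Matrix (Fin 2) (Fin 2) K}
    (hΘd : Valued.v Θ.det = Valued.v ϖ) (hΘt : Valued.v Θ.trace ≤ Valued.v ϖ) {a b : K} {k N : ℕ}
    (ha : Valued.v a = Valued.v ϖ ^ k) (hb : Valued.v b = Valued.v ϖ ^ N) :
    Valued.v (a • (1 : Matrix (Fin 2) (Fin 2) K) + b • Θ).det = Valued.v ϖ ^ min (2 * k) (2 * N + 1) := by
  have hΘt' := hΘt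
  rw [v_det_smul_one_add_smul_eq_max hϖ hΘd hΘt' a b, ha, hb, hϖ, ← pow_mul, ← pow_mul, ← pow_succ, exp_neg_one_pow, exp_neg_one_pow, exp_neg_one_pow]
  rcases le_total (2 * k) (2 * N + 1) with h | h
  · rw [min_eq_left h, max_eq_left (by rw [exp_le_exp]; push_cast; omega)]
    push_cast; ring_nf
  · rw [min_eq_right h, max_eq_right (by rw [exp_le_exp]; push_cast; omega)]
    push_cast; ring_nf

/-- The value law at `a = 0`: `|det(0•1 + b•Θ)| = |ϖ|^{2N+1}`. [cite: SerreLocalFields1979, Ch. I §6 Prop. 17–18] -/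
theorem v_det_smul_one_add_smul_eq_pow_of_eq_zero {ϖ : K} (hϖ : Valued.v ϖ = exp (-1 : ℤ)) {Θ : Matrix (Fin 2) (Fin 2) K}
    (hΘd : Valued.v Θ.det = Valued.v ϖ) (hΘt : Valued.v Θ.trace ≤ Valued.v ϖ) {a b : K} {N : ℕ} (ha : a = 0) (hb : Valued.v b = Valued.v ϖ ^ N) :
    Valued.v (a • (1 : Matrix (Fin 2) (Fin 2) K) + b • Θ).det = Valued.v ϖ ^ (2 * N + 1) := by
  rw [v_det_smul_one_add_smul_eq_max hϖ hΘd hΘt a b, ha, hb, map_zero, zero_pow two_ne_zero, max_eq_right zero_le, ← pow_mul, ← pow_succ]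
  ring_nf

/-- **THE VALUE LAW, backwards (Eisenstein integral basis through the norm)**: `|det(p•1 + q•Θ)| ≤ 1 ⇒ |p| ≤ 1 ∧ |q| ≤ 1`. [cite: SerreLocalFields1979, Ch. I §6 Prop. 18] -/
theorem v_le_one_and_v_le_one_of_v_det_le_one {ϖ : K} (hϖ : Valued.v ϖ = exp (-1 : ℤ)) {Θ : Matrix (Fin 2) (Fin 2) K}
    (hΘd : Valued.v Θ.det = Valued.v ϖ) (hΘt : Valued.v Θ.trace ≤ Valued.v ϖ) {p q : K}
    (h : Valued.v (p • (1 : Matrix (Fin 2) (Fin 2) K) + q • Θ).det ≤ 1) : Valued.v p ≤ 1 ∧ Valued.v q ≤ 1 := by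
  have hϖ0 : Valued.v ϖ ≠ 0 := by rw [hϖ]; exact exp_ne_zero
  rw [v_det_smul_one_add_smul_eq_max hϖ hΘd hΘt p q, max_le_iff] at h
  obtain ⟨h1, h2⟩ := h
  constructor
  · rcases eq_or_ne p 0 with hp | hp
    · rw [hp, map_zero]; exact zero_le
    · have hp0 : Valued.v p ≠ 0 := (Valuation.ne_zero_iff _).2 hp
      rw [← exp_log hp0, ← exp_nsmul, ← exp_zero, exp_le_exp, two_nsmul] at h1
      rw [← exp_log hp0, ← exp_zero, exp_le_exp]
      omega
  · rcases eq_or_ne q 0 with hq | hq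
    · rw [hq, map_zero]; exact zero_le
    · have hq0 : Valued.v q ≠ 0 := (Valuation.ne_zero_iff _).2 hq
      rw [← exp_log hq0, hϖ, ← exp_nsmul, ← exp_add, ← exp_zero, exp_le_exp, two_nsmul] at h2
      rw [← exp_log hq0, ← exp_zero, exp_le_exp]
      omega

/-! ## §2 COORDINATES on `(1, Θ)` — pure algebra over a field -/

/-- `Θ = α•1 + β•g`, `β ≠ 0` ⇒ `u•1 − g = (u + αβ⁻¹)•1 + (−β⁻¹)•Θ`. [cite: Rogawski1990, §4.9 p. 55] -/
theorem smul_one_sub_eq_coord {F : Type*} [Field F] {g Θ : Matrix (Fin 2) (Fin 2) F} {α β : F} (hΘ : Θ = α • 1 + β • g) (hβ : β ≠ 0) (u : F) :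
    u • (1 : Matrix (Fin 2) (Fin 2) F) - g = (u + α * β⁻¹) • 1 + (-β⁻¹) • Θ := by
  rw [hΘ, smul_add, smul_smul, smul_smul, neg_mul, neg_mul, inv_mul_cancel₀ hβ]
  module

/-- `Θ = α•1 + β•g`, `β ≠ 0` ⇒ `g = (−αβ⁻¹)•1 + β⁻¹•Θ`. [cite: Rogawski1990, §4.9 p. 55] -/
theorem eq_coord_of_theta {F : Type*} [Field F] {g Θ : Matrix (Fin 2) (Fin 2) F} {α β : F} (hΘ : Θ = α • 1 + β • g) (hβ : β ≠ 0) :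
    g = (-(α * β⁻¹)) • (1 : Matrix (Fin 2) (Fin 2) F) + β⁻¹ • Θ := by
  rw [hΘ, smul_add, smul_smul, smul_smul, inv_mul_cancel₀ hβ, one_smul]
  module

/-- A root of `χ_{α•1 + β•g}` (`β ≠ 0`) yields a root of `χ_g`: `χ_{α•1+β•g}(r) = β²·χ_g((r − α)∕β)`. [cite: Rogawski1990, §4.9 Lemma 4.9.3 p. 56] -/
theorem exists_isRoot_charpoly_of_isRoot_charpoly_smul_one_add_smul {F : Type*} [Field F] (g : Matrix (Fin 2) (Fin 2) F) {α β : F} (hβ : β ≠ 0)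
    {r : F} (hr : (α • (1 : Matrix (Fin 2) (Fin 2) F) + β • g).charpoly.IsRoot r) : ∃ s : F, g.charpoly.IsRoot s := by
  refine ⟨(r - α) * β⁻¹, ?_⟩
  rw [Matrix.charpoly_fin_two, Polynomial.IsRoot.def] at hr ⊢
  simp only [eval_add, eval_sub, eval_mul, eval_pow, eval_C, eval_X] at hr ⊢
  rw [det_smul_one_add_smul_fin_two, Matrix.trace_add, Matrix.trace_smul, Matrix.trace_smul, Matrix.trace_one, Fintype.card_fin] at hr
  simp only [Nat.cast_ofNat, smul_eq_mul] at hr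
  field_simp
  linear_combination hr

/-! ## §3 HENSEL: an element of the order whose characteristic polynomial has no root in `K` and whose norm is non-unit has trace in `𝔪` -/

/-- **`χ_x` without a root in `K`, `|det x| < 1` ⇒ `|tr x| < 1`** (`K` with Henselian valuation ring: else `Y² − Y + det x∕(tr x)²` lifts its simple residual root `0` and
`tr x · y₀` is a root of `χ_x = X² − tr x·X + det x`). [cite: SerreLocalFields1979, Ch. II §4 Prop. 7; Ch. I §6 Prop. 17] -/
theorem v_trace_lt_one_of_not_exists_isRoot_of_v_det_lt_one [HenselianLocalRing 𝒪[K]] (x : Matrix (Fin 2) (Fin 2) K)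
    (hirr : ¬ ∃ s : K, x.charpoly.IsRoot s) (hdet : Valued.v x.det < 1) : Valued.v x.trace < 1 := by
  by_contra ht
  rw [not_lt] at ht
  set t := x.trace with ht_def
  set δ := x.det with hδ_def
  have ht0 : t ≠ 0 := by
    intro h
    rw [h, map_zero] at ht
    exact not_lt.2 ht zero_lt_one
  have hvt0 : Valued.v t ≠ 0 := (Valuation.ne_zero_iff _).2 ht0
  -- `c := δ ∕ t²` lies in the maximal ideal
  have hc : Valued.v (δ * (t⁻¹) ^ 2) < 1 := by
    rw [map_mul, map_pow, map_inv₀]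
    have hi : (Valued.v t)⁻¹ ≤ 1 := inv_le_one_of_one_le₀ ht
    calc Valued.v δ * (Valued.v t)⁻¹ ^ 2 ≤ Valued.v δ * 1 := mul_le_mul_right (pow_le_one₀ zero_le hi) _
      _ < 1 := by rw [mul_one]; exact hdet
  let c : 𝒪[K] := ⟨δ * (t⁻¹) ^ 2, le_of_lt hc⟩
  have hcm : (c : 𝒪[K]) ∈ IsLocalRing.maximalIdeal 𝒪[K] := by
    rw [IsLocalRing.mem_maximalIdeal, mem_nonunits_iff, Valuation.Integer.not_isUnit_iff_valuation_lt_one]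
    exact hc
  -- Hensel on `Y² − Y + c` at the simple residual root `0`
  have hmon : (X ^ 2 - X + C c : 𝒪[K][X]).Monic := by monicity!
  obtain ⟨y, hy, -⟩ := HenselianLocalRing.is_henselian (X ^ 2 - X + C c) hmon 0 (by simpa using hcm) (by simp)
  rw [Polynomial.IsRoot.def] at hy
  simp only [eval_add, eval_sub, eval_pow, eval_X, eval_C] at hy
  have hcK : ((c : 𝒪[K]) : K) = δ * (t⁻¹) ^ 2 := rfl
  have hyK : ((y : 𝒪[K]) : K) ^ 2 - (y : K) + δ * (t⁻¹) ^ 2 = 0 := by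
    have := congrArg (fun z : 𝒪[K] => (z : K)) hy
    simpa [hcK] using this
  -- `t·y` is a root of `χ_x`
  apply hirr
  refine ⟨t * y, ?_⟩
  rw [Matrix.charpoly_fin_two, Polynomial.IsRoot.def]
  simp only [eval_add, eval_sub, eval_mul, eval_pow, eval_C, eval_X]
  have e : (t * (y : K)) ^ 2 - t * (t * y) + δ = t ^ 2 * (((y : 𝒪[K]) : K) ^ 2 - (y : K) + δ * (t⁻¹) ^ 2) := by
    rw [mul_add, mul_sub, inv_pow, mul_comm δ, ← mul_assoc (t ^ 2), mul_inv_cancel₀ (pow_ne_zero 2 ht0), one_mul]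
    ring
  rw [← ht_def, ← hδ_def, e, hyK, mul_zero]

/-- A norm-uniformiser of the order is an EISENSTEIN generator: `|det Θ| = |ϖ| = exp(−1)`, `χ_Θ` rootless ⇒ `|tr Θ| < 1` and `|tr Θ| ≤ |ϖ|`. [cite: SerreLocalFields1979, Ch. I §6 Prop. 17–18] -/
theorem v_trace_lt_one_and_le_of_v_det_eq [HenselianLocalRing 𝒪[K]] {ϖ : K} (hϖ : Valued.v ϖ = exp (-1 : ℤ)) (Θ : Matrix (Fin 2) (Fin 2) K)
    (hirr : ¬ ∃ s : K, Θ.charpoly.IsRoot s) (hΘd : Valued.v Θ.det = Valued.v ϖ) : Valued.v Θ.trace < 1 ∧ Valued.v Θ.trace ≤ Valued.v ϖ := by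
  have hlt : Valued.v Θ.trace < 1 :=
    v_trace_lt_one_of_not_exists_isRoot_of_v_det_lt_one Θ hirr (by rw [hΘd, hϖ, ← exp_zero, exp_lt_exp]; norm_num)
  exact ⟨hlt, by rw [hϖ]; exact (Literature.NumberTheory.LocalFields.lt_one_iff_le_exp_neg_one _).1 hlt⟩

/-! ## §4 EXISTENCE OF THE EISENSTEIN DATA `(Θ, α, β, a, b, n′, N′)` in ★ (W1)'s `hT` binder shape, from the ramified witness `hram` -/

/-- **EISENSTEIN DATA OF A TYPE-(2) ELEMENT.**  `K` with Henselian valuation ring, `ϖ` a uniformiser, `g ∈ M₂(K)` with `χ_g` rootless in `K` (★ head's `hirr`) and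
`|det g| ≤ 1`, `u ∈ K` with `|u| ≤ 1`, and the seam binder `hram : |det(α₀•1 + β₀•g)| = |ϖ|` («`K[g]∕K` ramified»).  THEN there are `Θ α β a b n′ N′` with — token for token
the six clauses of ★ `UnitaryLatticeTree.ncard_vertex_rowZero_eq_of_total`'s `hT` — `Θ = α•1 + β•g`, `|det Θ| = |ϖ|`, `|tr Θ| < 1`, `u•1 − g = a•1 + b•Θ`, `|det(u•1 − g)| = |ϖ|^{n′}`,
`|b| = |ϖ|^{N′}`; AND the value law `(a = 0 ∧ n′ = 2N′+1) ∨ (∃ k, |a| = |ϖ|^k ∧ n′ = min(2k, 2N′+1))`, whence `Even n′ ∨ n′ = 2N′+1` and `n′ ≤ 2N′+1` (the ★ head's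
`hpar`∕`hnN` as theorems).  No `2`, no different exponent. [cite: SerreLocalFields1979, Ch. I §6 Prop. 17–18; Ch. II §4 Prop. 7] [cite: Rogawski1990, §4.9 Prop. 4.9.1 (b) p. 55] [cite: Omeara1963, §63A] -/
theorem exists_eisensteinData [HenselianLocalRing 𝒪[K]] {ϖ : K} (hϖ : Valued.v ϖ = exp (-1 : ℤ)) (g : Matrix (Fin 2) (Fin 2) K)
    (hirr : ¬ ∃ s : K, g.charpoly.IsRoot s) (hδ : Valued.v g.det ≤ 1) (u : K) (hu : Valued.v u ≤ 1)
    {α₀ β₀ : K} (hram : Valued.v (α₀ • (1 : Matrix (Fin 2) (Fin 2) K) + β₀ • g).det = Valued.v ϖ) :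
    ∃ (Θ : Matrix (Fin 2) (Fin 2) K) (α β a b : K) (n' N' : ℕ),
      Θ = α • 1 + β • g ∧ Valued.v Θ.det = Valued.v ϖ ∧ Valued.v Θ.trace < 1 ∧ u • 1 - g = a • 1 + b • Θ ∧
        Valued.v (u • 1 - g).det = Valued.v ϖ ^ n' ∧ Valued.v b = Valued.v ϖ ^ N' ∧
        ((a = 0 ∧ n' = 2 * N' + 1) ∨ ∃ k : ℕ, Valued.v a = Valued.v ϖ ^ k ∧ n' = min (2 * k) (2 * N' + 1)) ∧
        (Even n' ∨ n' = 2 * N' + 1) ∧ n' ≤ 2 * N' + 1 := by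
  set Θ := α₀ • (1 : Matrix (Fin 2) (Fin 2) K) + β₀ • g with hΘdef
  have hβ0 : β₀ ≠ 0 := by
    intro h
    have hdet : Valued.v (α₀ • (1 : Matrix (Fin 2) (Fin 2) K) + β₀ • g).det = Valued.v α₀ ^ 2 := by
      rw [h, zero_smul, add_zero, Matrix.det_smul, Matrix.det_one, mul_one, Fintype.card_fin, map_pow]
    have hne := sq_ne_sq_mul_exp_neg_one (γ := Valued.v α₀) (δ := 1) (Or.inr one_ne_zero)
    rw [one_pow, one_mul, ← hϖ, ← hdet] at hne
    exact hne hram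
  -- `χ_Θ` is rootless (§2), so `Θ` is an Eisenstein generator (§3)
  have hirrΘ : ¬ ∃ s : K, Θ.charpoly.IsRoot s := fun ⟨s, hs⟩ =>
    hirr (exists_isRoot_charpoly_of_isRoot_charpoly_smul_one_add_smul g hβ0 hs)
  obtain ⟨hΘt, hΘt'⟩ := v_trace_lt_one_and_le_of_v_det_eq hϖ Θ hirrΘ hram
  -- coordinates (§2) and their integrality (§1 backwards, from `|det g| ≤ 1`)
  have hg : g = (-(α₀ * β₀⁻¹)) • (1 : Matrix (Fin 2) (Fin 2) K) + β₀⁻¹ • Θ := eq_coord_of_theta hΘdef hβ0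
  have hrel : u • (1 : Matrix (Fin 2) (Fin 2) K) - g = (u + α₀ * β₀⁻¹) • 1 + (-β₀⁻¹) • Θ := smul_one_sub_eq_coord hΘdef hβ0 u
  have hcoord := v_le_one_and_v_le_one_of_v_det_le_one hϖ hram hΘt' (p := -(α₀ * β₀⁻¹)) (q := β₀⁻¹) (by rw [← hg]; exact hδ)
  obtain ⟨N, hN⟩ := exists_v_eq_exp_neg_nat (x := -β₀⁻¹) (neg_ne_zero.2 (inv_ne_zero hβ0)) (by rw [Valuation.map_neg]; exact hcoord.2)
  have hbN : Valued.v (-β₀⁻¹) = Valued.v ϖ ^ N := by rw [hN, hϖ, exp_neg_one_pow]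
  have ha1 : Valued.v (u + α₀ * β₀⁻¹) ≤ 1 := Valuation.map_add_le _ hu (by rw [← Valuation.map_neg]; exact hcoord.1)
  rcases eq_or_ne (u + α₀ * β₀⁻¹) 0 with ha0 | ha0
  · refine ⟨Θ, α₀, β₀, u + α₀ * β₀⁻¹, -β₀⁻¹, 2 * N + 1, N, hΘdef, hram, hΘt, hrel, ?_, hbN, Or.inl ⟨ha0, rfl⟩, Or.inr rfl, le_rfl⟩
    rw [hrel]
    exact v_det_smul_one_add_smul_eq_pow_of_eq_zero hϖ hram hΘt' ha0 hbN
  · obtain ⟨k, hk⟩ := exists_v_eq_exp_neg_nat ha0 ha1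
    have hak : Valued.v (u + α₀ * β₀⁻¹) = Valued.v ϖ ^ k := by rw [hk, hϖ, exp_neg_one_pow]
    refine ⟨Θ, α₀, β₀, u + α₀ * β₀⁻¹, -β₀⁻¹, min (2 * k) (2 * N + 1), N, hΘdef, hram, hΘt, hrel, ?_, hbN, Or.inr ⟨k, hak, rfl⟩, ?_,
      min_le_right _ _⟩
    · rw [hrel]
      exact v_det_smul_one_add_smul_eq_pow_min hϖ hram hΘt' hak hbN
    · rcases le_total (2 * k) (2 * N + 1) with h | h
      · rw [min_eq_left h]; exact Or.inl (even_two_mul k)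
      · rw [min_eq_right h]; exact Or.inr rfl

/-! ## §5 THE `|2| = 1` DICTIONARY (corollary): `Θ = ϖ^{−N}•(2•g − tr g•1)`, `N′ = N`, every ★ tame row is the `d = 1` instance -/

/-- `det(2•g − tr g•1) = −(tr g² − 4·det g)` and `tr(2•g − tr g•1) = 0` (`2 × 2`, any commutative ring). [cite: Rogawski1990, §4.9 p. 55] -/
theorem det_two_smul_sub_trace_smul_one {R : Type*} [CommRing R] (g : Matrix (Fin 2) (Fin 2) R) :
    ((2 : R) • g - g.trace • (1 : Matrix (Fin 2) (Fin 2) R)).det = -(g.trace ^ 2 - 4 * g.det) ∧ ((2 : R) • g - g.trace • (1 : Matrix (Fin 2) (Fin 2) R)).trace = 0 := by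
  constructor
  · simp only [Matrix.det_fin_two, Matrix.trace_fin_two, Matrix.sub_apply, Matrix.smul_apply, Matrix.one_apply, smul_eq_mul]
    simp
    ring
  · simp only [Matrix.trace_fin_two, Matrix.sub_apply, Matrix.smul_apply, Matrix.one_apply, smul_eq_mul]
    simp
    ring

/-- **THE TAME RAMIFIED WITNESS**: `|2| = 1`, `|tr g² − 4 det g| = |ϖ|^{2N+1}` (the ★ head's `hN`) ⇒ `Θ := ϖ^{−N} • (2•g − tr g•1) = (−ϖ^{−N}·tr g)•1 + (2ϖ^{−N})•g` has
`|det Θ| = |ϖ|`, `tr Θ = 0`, and `u•1 − g = (u − tr g·2⁻¹)•1 + (−(ϖ^N·2⁻¹))•Θ` with `|−(ϖ^N·2⁻¹)| = |ϖ|^N` — so §4's `hram` holds and `N′ = N`: every TAME ★ row is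
the `d = 1` instance of the Eisenstein data — the `(h2, hN)` binders of ★ `finsum_finExplicitDelta_mul_classOrbitalIntegral_depthZero_eq_of_irreducible`
(`DepthZeroKappaTransferTypeTwoGSide` :244–:245), ★ `ncard_rankStrata_zero_eq_phiTHn_of_finKappaAt_eq_one` ∕ `…phiTHprimen_of_finKappaAt_eq_neg_one` (`DepthZeroKappaTransferTypeTwoRowZero`),
★ `classOrbitalIntegral_indicator_eq_phiTHn_of_finKappaAt_eq_one` (`UnitFundamentalLemmaInertIrredValuePos`) feed this corollary verbatim (their `hN` is stated with
`WithZero.exp (−(2N+1))`; rewrite with `exp_neg_one_pow`). [cite: Rogawski1990, §4.9 Prop. 4.9.1 (b) p. 55] [cite: SerreLocalFields1979, Ch. I §6 Prop. 17] -/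
theorem eisensteinData_of_v_two_eq_one {ϖ : K} (hϖ : Valued.v ϖ = exp (-1 : ℤ)) (hϖ0 : ϖ ≠ 0) (h2 : Valued.v (2 : K) = 1) (g : Matrix (Fin 2) (Fin 2) K) {N : ℕ}
    (hN : Valued.v (g.trace ^ 2 - 4 * g.det) = Valued.v ϖ ^ (2 * N + 1)) (u : K) :
    (ϖ ^ N)⁻¹ • ((2 : K) • g - g.trace • (1 : Matrix (Fin 2) (Fin 2) K)) = (-((ϖ ^ N)⁻¹ * g.trace)) • 1 + (2 * (ϖ ^ N)⁻¹) • g ∧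
      Valued.v ((ϖ ^ N)⁻¹ • ((2 : K) • g - g.trace • (1 : Matrix (Fin 2) (Fin 2) K))).det = Valued.v ϖ ∧
      ((ϖ ^ N)⁻¹ • ((2 : K) • g - g.trace • (1 : Matrix (Fin 2) (Fin 2) K))).trace = 0 ∧
      u • (1 : Matrix (Fin 2) (Fin 2) K) - g = (u - g.trace * 2⁻¹) • 1 + (-(ϖ ^ N * 2⁻¹)) • ((ϖ ^ N)⁻¹ • ((2 : K) • g - g.trace • (1 : Matrix (Fin 2) (Fin 2) K))) ∧
      Valued.v (-(ϖ ^ N * (2 : K)⁻¹)) = Valued.v ϖ ^ N := by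
  have hϖv0 : Valued.v ϖ ≠ 0 := by rw [hϖ]; exact exp_ne_zero
  have h20 : (2 : K) ≠ 0 := (Valuation.ne_zero_iff _).1 (by rw [h2]; exact one_ne_zero)
  have hϖN : ϖ ^ N ≠ 0 := pow_ne_zero N hϖ0
  obtain ⟨hd, htr⟩ := det_two_smul_sub_trace_smul_one g
  refine ⟨by module, ?_, ?_, ?_, ?_⟩
  · rw [Matrix.det_smul, Fintype.card_fin, hd, map_mul, Valuation.map_neg, hN, map_pow, map_inv₀, map_pow,
      show Valued.v ϖ ^ (2 * N + 1) = (Valued.v ϖ ^ N) ^ 2 * Valued.v ϖ by rw [pow_succ, pow_mul'], ← mul_assoc, inv_pow,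
      inv_mul_cancel₀ (pow_ne_zero 2 (pow_ne_zero N hϖv0)), one_mul]
  · rw [Matrix.trace_smul, htr, smul_zero]
  · have e : -(ϖ ^ N * (2 : K)⁻¹) * (ϖ ^ N)⁻¹ = -(2 : K)⁻¹ := by field_simp
    rw [smul_smul, e, smul_sub, smul_smul, smul_smul, neg_mul, neg_mul, inv_mul_cancel₀ h20]
    module
  · rw [Valuation.map_neg, map_mul, map_inv₀, h2, inv_one, mul_one, map_pow]

end Literature.NumberTheory.Rogawski1990

end
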